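import Mathlib.MeasureTheory.Measure.Lebesgue.VolumeOfBalls
import Mathlib.MeasureTheory.Measure.Haar.InnerProductSpace
import Summits.Ventures.Crystal3D.StickySpheres.ContactGraph
import HarnessLib

/-!
# CELLFLUX — DEFINITIONS file (planner cf-p1 gen 15 statement file, landed verbatim by wulff-p1 g5;
# imports made route-independent: no `Theses` import; declarations unchanged)

Landed as `Theorems/StickyWulffConstantNoReconstructionGainCellFluxDefs.lean` (--supports
stmt-Ventures-19144, helper) so that the glue targets below (`ShadowCovering`, `BlanketOfLocalFlux`,
`BlanketOfPoolFlux`, …) can be proved BY NAME against these definitions.  Source: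
`HOME/cf-p1/route/lines/cellflux/CellFlux.lean` (lean check rc 0, sorry-free); the planner's module
docstring follows unchanged.
-/

/-!
# CELLFLUX — a calibrated exposed-area scheme reducing the `BlanketBound` to a LOCAL lemma
(planner p1, cell `crystal3d-full`, gen 15; evidence on stmt-Ventures-19144; companion of
`lines/blanket/Blanket.lean` (gen 14) and of the in-tree exposed-area LP
`Summits/Ventures/Crystal3D/Inequalities/ExposedAreaDeficit.lean`; statement file — conjectures and
provable targets, sorry-free, NOT a line concluding the crux).

SETTING.  `x` a finite unit packing (diameter `1`), `ν` a unit vector, `degᵢ` the coordination.  The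
blanket bound (g14) is `2√3 · S_ν(x; 1/√3) ≤ 6N − C(x)`, `S_ν(x; r)` = area of the `ν`-shadow of
`⋃ᵢ B̄(xᵢ, r)`; it implies `NoReconstructionGain` at the basal normals `±e₃` for every coordination.

THE SCHEME (parameters `a ≥ 1/√3`, `κ > 0`; main scheme `a = a₀ := (√3/π)^{1/2} = 0.74252`, `κ = 1`).
Give every ball the solid body `Cᵢ = xᵢ + {lateral²/a² + vertical²/(κa)² ≤ 1}` (a spheroid aligned with
`ν`) and let `K = ⋃ᵢ Cᵢ`.  The CELL FLUX `τᵢ(ν)` of ball `i` is the shadow area of the part of the upper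
half of `∂Cᵢ` lying in no other open body, plus the same for the lower half (`cellFlux`; frame-free as
slab volumes, like `shadowSlab`).  Then
* (CF1) `S_ν(x; 1/√3) ≤ S_ν(x; a) = |π_ν K|` (monotonicity, `1/√3 ≤ a`);
* (CF2) `2 |π_ν K| ≤ Σᵢ τᵢ(ν)` (`ShadowCovering`): over every point of the shadow the top point of `K`
  is the top point of some `Cᵢ` and lies in no open `Cⱼ`; same for bottom points.  TRUE for all
  `a, κ > 0`, size M (pointwise inclusion `shadowSlab ⊆ ⋃ᵢ upperFreeSlab i` + `measure_iUnion_le`);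
* (CF3) the LOCAL LEMMA, term-wise form: `2√3 · τᵢ(ν) ≤ 12 − degᵢ` (`LocalFluxBoundAt a κ d`);
  star form (one round of discharging along contacts, share `λ`): `(1−λ) eᵢ + λ Σ_{j∼i} eⱼ/degⱼ ≤ 0`
  with `eᵢ = 2√3 τᵢ − (12 − degᵢ)` (`StarFluxBound a κ λ`).
(CF1)+(CF2)+(CF3) ⟹ `BlanketBound` by summation and the handshake `Σ degᵢ = 2 C(x)`
(`BlanketOfLocalFlux`, `BlanketOfStarFlux`: provable glue, size S/M).

In the direction parametrisation `u ∈ S²` of `∂Cᵢ` (`p = xᵢ + A u`, `A = diag(a, a, κa)` in a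
`ν`-frame) one has `τᵢ = a² Λᵢ`, `Λᵢ(ν) = ∫_{Fᵢ} |u·ν| dσ(u)`, `Fᵢ = {u : u·zⱼ ≤ |zⱼ|²/2 ∀ j ≠ i}`,
`zⱼ = A⁻¹(xⱼ − xᵢ)`: each neighbour removes a CAP; at `κ = 1` a contact neighbour removes the cap of
angular radius `α₀ = arccos(1/(2a₀)) = 47.67°` about its direction, independently of `ν`.
EXACT TIGHT CASES of the term-wise form at `(a₀, 1)`: `deg = 0` (isolated body: `τ = 2πa₀² = 2√3`,
this FIXES `a₀`); `deg = 6` planar hexagon `⊥ ν` (free shadow = the hexagonal Voronoi cell, `τ = √3`,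
for every `a ≥ 1/√3`); `deg = 9` = hexagon + three below (`(111)` surface atom: lower hemisphere covered
with margin `2.7°`, `τ = √3/2`); `deg = 12` fcc / hcp shells (covering radius `45° < α₀`: `τ = 0`).
So the scheme is a discrete CALIBRATION: tight exactly on Barlow films `⊥ ν` at every stage of their
layer-by-layer dissolution, like the blanket bound itself.

NUMERICAL STATUS (kit j273628 = exact structures A0, max-hole codes A1, adversarial codes A2, shell subsets A3;
j274484 = 110-structure zoo with the chain and the star / pool / rim-pool statistics; j274481 = bare and grown
violator clusters + 78 thin ALL-SURFACE slabs; README §2 for the tables).  TERM-WISE (CF3′) at `(a₀, 1)`: exact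
equality at `d = 0`, `6` (hexagon `⊥ ν`), `9` (the `(111)` 9-shell; `Q₉ = 90°` exactly), `12` (fcc/hcp/ico);
strict at `d ≤ 5` (`−0.145`, the one-contact plateau), `7` (`≈ −0.24`), `10` (`≈ −0.05`); FALSE at exactly two
degrees — `d = 8` (one-sided, equator-hugging codes: max-hole code `4 × 95.5° + 2 × 125.3° + 2 × 150°`, excess
`+0.070` in `Λ`-units `= 3.3 %` of the budget `4π/6`; the hcp `(10-10)` prism-facet atom `+0.016…+0.022`) and
`d = 11` (icosahedral shell minus one ball, relaxed: `+0.068`).  `d = 12` holds by `0.015°`: `Q₁₂ = 47.6564°`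
(largest hole found in a 12-point kissing code: `C2v`, 23 contacts) against `α₀ = 47.6713°`, so the scheme has
NO free parameter (`a ∈ [1/(2 cos Q₁₂), a₀] = [0.74236, 0.74252]`) and no `(a, κ)` repairs `d = 8` and `d = 11`
together (level-neighbour shadows are the planar Voronoi cell for EVERY body of revolution).  POOL
(`PoolFluxBound a₀ 1`): `≤ 0` on all 259 structures in all six `(a, κ)` schemes tried (max `+0.0003` = grid
noise on tight Barlow films); at every violator the first-shell slack shares exceed its excess by a factor
`≥ 2.8` (worst: 6-row hcp prism window `−0.039`, hcp `(010)` slab `−0.098`, grown `1+8` cluster `−0.082`).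
STAR is the wrong form (passes at `λ = 0.2` by `0.003` only, fails at `λ = 0.1`): it charges slack-free balls for
violating neighbours.  Blanket margin `≥ 2.4` e-units everywhere (consistent with g14's j271947).  HENCE THE LOCAL
LEMMA TO PROVE IS `PoolFluxBound fluxRadius 1` (2-local; `RimPoolFluxBound` is its robust variant with the CF1
slack returned to boundary balls), with the term-wise table for `d ∉ {8, 11}` and `TwelveCodeCovering` as its
certifiable first rungs.

WHAT THIS IS NOT: not a proof of `BlanketBound`; `LocalFluxBound a₀ 1` (all `d`) is numerically FALSE
(by `3.3 %` at `d = 8`, `12.9 %` at `d = 11`) and is kept only through its per-degree instances; the pool /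
rim-pool forms are conjectures with census support; `Q₁₂ < α₀` is a numerical lower-bound statement, not
certified; rung F-C1 not moved.
-/

noncomputable section

open scoped BigOperators InnerProductSpace
open MeasureTheory Finset

namespace Summit.Ventures.Crystal3D.Cruxes.NoReconstructionGain.CellFlux

open Summit.Ventures.Crystal3D

/-! ### Blanket-side notions (verbatim from `lines/blanket/Blanket.lean`, gen 14) -/

/-- Squared lateral distance of `y` from the axis through `c` in direction `ν` (`‖ν‖ = 1`). -/
def lateralSq (ν c y : EuclideanSpace ℝ (Fin 3)) : ℝ := ‖y - c‖ ^ 2 - ⟪y - c, ν⟫_ℝ ^ 2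

/-- The unit-height slab of the `ν`-shadow cylinder of the balls `B̄(x i, r)` (volume = shadow area). -/
def shadowSlab (ν : EuclideanSpace ℝ (Fin 3)) (r : ℝ) {N : ℕ}
    (x : Fin N → EuclideanSpace ℝ (Fin 3)) : Set (EuclideanSpace ℝ (Fin 3)) :=
  {y | (∃ i, lateralSq ν (x i) y ≤ r ^ 2) ∧ |⟪y, ν⟫_ℝ| ≤ 1 / 2}

/-- The shadow area `S_ν(x; r)`. -/
def shadowArea (ν : EuclideanSpace ℝ (Fin 3)) (r : ℝ) {N : ℕ}
    (x : Fin N → EuclideanSpace ℝ (Fin 3)) : ℝ :=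
  (volume (shadowSlab ν r x)).toReal

/-- The blanket radius `1/√3`. -/
def blanketRadius : ℝ := (Real.sqrt 3)⁻¹

/-- **BLANKET BOUND** (conjecture, g14): `2√3 · S_ν(x; 1/√3) ≤ 6 N − C(x)`. -/
def BlanketBound : Prop :=
  ∀ (N : ℕ) (x : Fin N → EuclideanSpace ℝ (Fin 3)), IsUnitPacking x →
    ∀ ν : EuclideanSpace ℝ (Fin 3), ‖ν‖ = 1 →
      2 * Real.sqrt 3 * shadowArea ν blanketRadius x ≤ 6 * (N : ℝ) - (numContacts x : ℝ)

/-! ### The bodies and the cell flux -/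

/-- The calibrating lateral radius `a₀ = (√3/π)^{1/2} ≈ 0.74252`: `2π a₀² = 2√3`, i.e. an isolated body
pays exactly its deficit `12`. -/
def fluxRadius : ℝ := Real.sqrt (Real.sqrt 3 / Real.pi)

/-- The lateral offset vector of `y` from the axis through `c` in direction `ν`. -/
def lateral (ν c y : EuclideanSpace ℝ (Fin 3)) : EuclideanSpace ℝ (Fin 3) :=
  (y - c) - ⟪y - c, ν⟫_ℝ • ν

/-- `p` lies in the OPEN body (spheroid, lateral semi-axis `a`, vertical semi-axis `κ a`, axis `ν`)
centred at `c`. -/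
def InOpenBody (ν : EuclideanSpace ℝ (Fin 3)) (a κ : ℝ) (c p : EuclideanSpace ℝ (Fin 3)) : Prop :=
  lateralSq ν c p / a ^ 2 + ⟪p - c, ν⟫_ℝ ^ 2 / (κ * a) ^ 2 < 1

/-- The top point of the body centred at `c` above the lateral position of `y`. -/
def topPoint (ν : EuclideanSpace ℝ (Fin 3)) (a κ : ℝ) (c y : EuclideanSpace ℝ (Fin 3)) :
    EuclideanSpace ℝ (Fin 3) :=
  c + lateral ν c y + (κ * Real.sqrt (a ^ 2 - lateralSq ν c y)) • ν

/-- The bottom point of the body centred at `c` below the lateral position of `y`. -/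
def bottomPoint (ν : EuclideanSpace ℝ (Fin 3)) (a κ : ℝ) (c y : EuclideanSpace ℝ (Fin 3)) :
    EuclideanSpace ℝ (Fin 3) :=
  c + lateral ν c y - (κ * Real.sqrt (a ^ 2 - lateralSq ν c y)) • ν

/-- Unit-height slab over the UPPER FREE SHADOW of ball `i`: lateral positions inside `i`'s disc of
radius `a` whose top point of `Cᵢ` lies in no other open body. -/
def upperFreeSlab (ν : EuclideanSpace ℝ (Fin 3)) (a κ : ℝ) {N : ℕ}
    (x : Fin N → EuclideanSpace ℝ (Fin 3)) (i : Fin N) : Set (EuclideanSpace ℝ (Fin 3)) :=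
  {y | lateralSq ν (x i) y ≤ a ^ 2 ∧ |⟪y, ν⟫_ℝ| ≤ 1 / 2 ∧
        ∀ j, j ≠ i → ¬ InOpenBody ν a κ (x j) (topPoint ν a κ (x i) y)}

/-- Unit-height slab over the LOWER FREE SHADOW of ball `i`. -/
def lowerFreeSlab (ν : EuclideanSpace ℝ (Fin 3)) (a κ : ℝ) {N : ℕ}
    (x : Fin N → EuclideanSpace ℝ (Fin 3)) (i : Fin N) : Set (EuclideanSpace ℝ (Fin 3)) :=
  {y | lateralSq ν (x i) y ≤ a ^ 2 ∧ |⟪y, ν⟫_ℝ| ≤ 1 / 2 ∧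
        ∀ j, j ≠ i → ¬ InOpenBody ν a κ (x j) (bottomPoint ν a κ (x i) y)}

/-- The CELL FLUX `τᵢ(ν)`: upper plus lower free shadow areas of ball `i`
(`= a² ∫_{Fᵢ} |u·ν| dσ(u)` in the direction parametrisation). -/
def cellFlux (ν : EuclideanSpace ℝ (Fin 3)) (a κ : ℝ) {N : ℕ}
    (x : Fin N → EuclideanSpace ℝ (Fin 3)) (i : Fin N) : ℝ :=
  (volume (upperFreeSlab ν a κ x i)).toReal + (volume (lowerFreeSlab ν a κ x i)).toReal

/-- The EXCESS of ball `i`: `eᵢ = 2√3 τᵢ − (12 − degᵢ)` (the local lemma says `eᵢ ≤ 0`). -/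
def excess (ν : EuclideanSpace ℝ (Fin 3)) (a κ : ℝ) {N : ℕ}
    (x : Fin N → EuclideanSpace ℝ (Fin 3)) (i : Fin N) : ℝ :=
  2 * Real.sqrt 3 * cellFlux ν a κ x i - (12 - (coordination x i : ℝ))

/-! ### (CF2) the covering lemma — claimed TRUE, size M -/

/-- **(CF2) `ShadowCovering`**: twice the shadow of `⋃ᵢ Cᵢ` is at most the total cell flux (every top
point of the union is a free top point of some body; same for bottom points).  No packing hypothesis. -/
def ShadowCovering (a κ : ℝ) : Prop :=
  ∀ (N : ℕ) (x : Fin N → EuclideanSpace ℝ (Fin 3)) (ν : EuclideanSpace ℝ (Fin 3)), ‖ν‖ = 1 →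
    2 * shadowArea ν a x ≤ ∑ i, cellFlux ν a κ x i

/-! ### (CF3) the local lemma -/

/-- **(CF3) term-wise local flux bound at coordination `d`**: a ball with `d` contacts has
`2√3 · τᵢ(ν) ≤ 12 − d` for every unit `ν`.  At `(a, κ) = (fluxRadius, 1)`: `d = 0` is an identity
(trivially true), `d = 12` is `TwelveCodeCovering (1/(2a))`; numerically true with margin for
`d ∉ {7, 8}` (README), FALSE for `d = 8` (one-sided codes; excess up to `3.6 %`). -/
def LocalFluxBoundAt (a κ : ℝ) (d : ℕ) : Prop :=
  ∀ (N : ℕ) (x : Fin N → EuclideanSpace ℝ (Fin 3)), IsUnitPacking x →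
    ∀ ν : EuclideanSpace ℝ (Fin 3), ‖ν‖ = 1 → ∀ i, coordination x i = d →
      2 * Real.sqrt 3 * cellFlux ν a κ x i ≤ 12 - (d : ℝ)

/-- The term-wise local lemma for every coordination (numerically FALSE at `(fluxRadius, 1)`, see the
module docstring; kept as the conjunction of its per-degree instances). -/
def LocalFluxBound (a κ : ℝ) : Prop := ∀ d, LocalFluxBoundAt a κ d

/-- **(CF3⋆) star local flux bound** (CONJECTURE at `(fluxRadius, 1)` for some `λ ∈ [0.1, 0.5]`): after
one round of discharging in which every ball keeps `1 − λ` of its excess and hands `λ/degⱼ` of it to each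
contact neighbour, every ball's charge is `≤ 0`.  A statement about the configuration within distance
`2 + 2a·max(1,κ)` of `xᵢ`. -/
def StarFluxBound (a κ lam : ℝ) : Prop :=
  ∀ (N : ℕ) (x : Fin N → EuclideanSpace ℝ (Fin 3)), IsUnitPacking x →
    ∀ ν : EuclideanSpace ℝ (Fin 3), ‖ν‖ = 1 → ∀ i,
      (1 - lam) * excess ν a κ x i
        + lam * ∑ j ∈ contactNeighbors x i, excess ν a κ x j / (coordination x j : ℝ) ≤ 0

/-- **CF3-POOL `PoolFluxBound a κ`** (the discharging form; planner p1 g15): every ball's positive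
excess is paid by the EQUAL SHARES of its contact neighbours' slack:
`e_i⁺ ≤ Σ_{j ∼ i} e_j⁻ / deg j` (`e⁺ = max e 0`, `e⁻ = max (−e) 0`).  Unlike the star average it never
penalises a tight ball (`e_i ≤ 0`) for violating neighbours, and a violator may draw on the FULL slack
share of each neighbour; summing, `Σ_i e_i ≤ Σ_i (e_i⁺ − Σ_{j∼i} e_j⁻/deg j) = Σ e⁺ − Σ_{deg j ≥ 1} e_j⁻ ≤ 0`
needs nothing but the handshake.  Census: README (kit j274409 / j274414, columns `pool`, `pool_half`). -/
def PoolFluxBound (a κ : ℝ) : Prop :=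
  ∀ (N : ℕ) (x : Fin N → EuclideanSpace ℝ (Fin 3)), IsUnitPacking x →
    ∀ ν : EuclideanSpace ℝ (Fin 3), ‖ν‖ = 1 → ∀ i,
      max (excess ν a κ x i) 0
        ≤ ∑ j ∈ contactNeighbors x i, max (-excess ν a κ x j) 0 / (coordination x j : ℝ)

/-- The RIM cell of ball `i`: the part of its `a`-disc (in projection along `ν`) covered by NO
`r`-disc and nearer to `xᵢ` than to every other centre (projected Voronoi ownership; ties are null).
`Σᵢ rimArea = S_ν(x; a) − S_ν(x; r)` = the slack of (CF1), which the pure cell-flux accounting wastes: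
for a bare cluster it is a whole annulus of width `a − r = 0.165`, for a film only its perimeter. -/
def rimSlab (ν : EuclideanSpace ℝ (Fin 3)) (a r : ℝ) {N : ℕ} (x : Fin N → EuclideanSpace ℝ (Fin 3))
    (i : Fin N) : Set (EuclideanSpace ℝ (Fin 3)) :=
  {y | lateralSq ν (x i) y ≤ a ^ 2 ∧ (∀ j, r ^ 2 < lateralSq ν (x j) y) ∧
    (∀ j, lateralSq ν (x i) y ≤ lateralSq ν (x j) y) ∧ |⟪y, ν⟫_ℝ| ≤ 1 / 2}

/-- The rim area `ρᵢ` of ball `i` (radii `a` outside, `blanketRadius` inside). -/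
def rimArea (ν : EuclideanSpace ℝ (Fin 3)) (a : ℝ) {N : ℕ} (x : Fin N → EuclideanSpace ℝ (Fin 3))
    (i : Fin N) : ℝ :=
  (volume (rimSlab ν a blanketRadius x i)).toReal

/-- Rim-corrected excess `gᵢ = eᵢ − 4√3 ρᵢ`: the identity
`2(6N − C) − 4√3 S(r) = 2√3 (Σ τ − 2 S(a)) + 4√3 Σ ρ − Σ e` shows `Σ g ≤ 0 ⟹ BlanketBound` given (CF2). -/
def rimExcess (ν : EuclideanSpace ℝ (Fin 3)) (a κ : ℝ) {N : ℕ} (x : Fin N → EuclideanSpace ℝ (Fin 3))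
    (i : Fin N) : ℝ :=
  excess ν a κ x i - 4 * Real.sqrt 3 * rimArea ν a x i

/-- **CF3-RIMPOOL `RimPoolFluxBound a κ`** (the most robust local form filed here): pool form on the
rim-corrected excesses, `g_i⁺ ≤ Σ_{j∼i} g_j⁻ / deg j`.  Bare clusters (the only term-wise violators found
that are not inside a crystal surface) carry rim credit `4√3 ρ` of order `1` per boundary ball. -/
def RimPoolFluxBound (a κ : ℝ) : Prop :=
  ∀ (N : ℕ) (x : Fin N → EuclideanSpace ℝ (Fin 3)), IsUnitPacking x →
    ∀ ν : EuclideanSpace ℝ (Fin 3), ‖ν‖ = 1 → ∀ i,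
      max (rimExcess ν a κ x i) 0
        ≤ ∑ j ∈ contactNeighbors x i, max (-rimExcess ν a κ x j) 0 / (coordination x j : ℝ)

/-- **`TwelveCodeCovering c`**: every 12-point kissing code (unit vectors pairwise at distance `≥ 1`,
i.e. angle `≥ 60°`) has covering radius `≤ arccos c` — every direction is within `arccos c` of a code
point.  Needed with `c = 1/(2a)`; at `a = fluxRadius`, `arccos c = 47.67°`; the regular fcc / hcp shells
have covering radius `45°`; numerically the maximum over kissing codes is `≥ 46.4°` (README: `Q₁₂`).
Musin–Tarasov's Tammes(13) `= 57.14°` gives the rigorous but useless `≤ 57.14°`. -/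
def TwelveCodeCovering (c : ℝ) : Prop :=
  ∀ W : Finset (EuclideanSpace ℝ (Fin 3)), W.card = 12 → (∀ w ∈ W, ‖w‖ = 1) →
    (∀ v ∈ W, ∀ w ∈ W, v ≠ w → 1 ≤ ‖v - w‖) →
      ∀ u : EuclideanSpace ℝ (Fin 3), ‖u‖ = 1 → ∃ w ∈ W, c ≤ ⟪u, w⟫_ℝ

/-! ### Glue targets (provable now) -/

/-- `(CF1)+(CF2)+(CF3 term-wise) ⟹ blanket` (size S/M: monotonicity of the shadow in the radius,
summation, handshake `Σ degᵢ = 2 C(x)` = `sum_coordination_eq`). -/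
def BlanketOfLocalFlux (a κ : ℝ) : Prop :=
  blanketRadius ≤ a → ShadowCovering a κ → LocalFluxBound a κ → BlanketBound

/-- `(CF1)+(CF2)+(CF3⋆) ⟹ blanket` (size S/M: summing the star charges returns `Σᵢ eᵢ` minus `λ` times
the excess of the isolated balls, which is `≤ 0` by the `d = 0` instance). -/
def BlanketOfStarFlux (a κ lam : ℝ) : Prop :=
  blanketRadius ≤ a → 0 ≤ lam → lam ≤ 1 → ShadowCovering a κ → LocalFluxBoundAt a κ 0 →
    StarFluxBound a κ lam → BlanketBound

/-- Glue (target, size S): POOL form ⇒ blanket (handshake: each slack share is used by exactly the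
`deg j` neighbours of `j`; isolated balls have `e ≤ 0` by `LocalFluxBoundAt a κ 0`). -/
def BlanketOfPoolFlux (a κ : ℝ) : Prop :=
  blanketRadius ≤ a → ShadowCovering a κ → LocalFluxBoundAt a κ 0 → PoolFluxBound a κ → BlanketBound

/-- Glue (target, size M): rim-pool form ⇒ blanket.  Needs, beyond `BlanketOfPoolFlux`, the partition
identity `Σᵢ rimArea ν a x i = shadowArea ν a x − shadowArea ν blanketRadius x` (projected Voronoi
ownership partitions `π_ν K ∖ S(r)` up to a null set). -/
def BlanketOfRimPool (a κ : ℝ) : Prop :=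
  blanketRadius ≤ a → ShadowCovering a κ → LocalFluxBoundAt a κ 0 → RimPoolFluxBound a κ → BlanketBound

/-- `deg = 12 ⟸ code covering` at `κ = 1` (size M: a contact neighbour at distance `1` contains the top
point of `Cᵢ` in direction `u` iff `⟪u, xⱼ − xᵢ⟫ > 1/(2a)`; with covering, no boundary point of a
12-coordinated ball is free, so `τᵢ = 0`).  Strict inequality in the covering is what is used; we ask
for `TwelveCodeCovering c` with some `c > 1/(2a)`. -/
def TwelveOfCovering (a : ℝ) : Prop :=
  (∃ c, 1 / (2 * a) < c ∧ TwelveCodeCovering c) → LocalFluxBoundAt a 1 12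

/-! ### Sanity -/

/-- The term-wise bound implies the star bound for every share `λ ∈ [0,1]` (so the star form is the
weaker, more robust local lemma). -/
theorem starFluxBound_of_localFluxBound {a κ lam : ℝ} (h0 : 0 ≤ lam) (h1 : lam ≤ 1)
    (h : LocalFluxBound a κ) : StarFluxBound a κ lam := by
  intro N x hx ν hν i
  have he : ∀ j, excess ν a κ x j ≤ 0 := by
    intro j
    have := h (coordination x j) N x hx ν hν j rfl
    unfold excess; linarith
  have hsum : ∑ j ∈ contactNeighbors x i, excess ν a κ x j / (coordination x j : ℝ) ≤ 0 :=
    Finset.sum_nonpos fun j _ => div_nonpos_of_nonpos_of_nonneg (he j) (Nat.cast_nonneg _)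
  nlinarith [he i, hsum]

/-- Term-wise ⇒ pool form (sanity: with all excesses `≤ 0` the left side is `0` and the right side is a
sum of non-negative shares). -/
theorem poolFluxBound_of_localFluxBound {a κ : ℝ} (h : LocalFluxBound a κ) : PoolFluxBound a κ := by
  intro N x hx ν hν i
  have hi : excess ν a κ x i ≤ 0 := by
    have := h (coordination x i) N x hx ν hν i rfl
    unfold excess; linarith
  rw [max_eq_right hi]
  exact Finset.sum_nonneg fun j _ => div_nonneg (le_max_right _ _) (Nat.cast_nonneg _)

end Summit.Ventures.Crystal3D.Cruxes.NoReconstructionGain.CellFlux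

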